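import Literature.NumberTheory.Automorphic.Liu2021.AppendixC.JacobianGaloisCoverTrace
import Literature.AlgebraicGeometry.Motives.SepQuotientPieces
import Literature.AlgebraicGeometry.Morphisms.CofanPieceMap
import Literature.AlgebraicGeometry.Motives.AlgPointsNonempty
import Literature.AlgebraicGeometry.Motives.VarietiesGeometricallyIntegralProofs
import HarnessLib

/-!
# The pull-back word `p^*` of a Galois cover of a NON-CONNECTED curve, read on the biproducts of piece Jacobians:
# `p^* ∘ p_* = Σ_δ δ_*` in FAN form, with the piecewise Galois groups and multiplicities (Lang VIII §6 Thm. 13; LR22 Prop. 3.5.1; SGA 1 V §1)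

Topic `NumberTheory/Automorphic/Liu2021/AppendixC`; namespace `Literature.NumberTheory.Automorphic.Liu2021.AppendixC` (prefix `Jacobian.`,
as ★ `JacobianGaloisCoverTrace`).  PROOF FILE (theorems only; no definition, no named fact, no instance, no `sorry`).  Everything is over `ℂ`.

SETTING.  A quotient `p : X′ → X` of a projective `ℂ`-scheme `X′` by a finite group `act : Δ →* Aut X′` for separated test objects
(★ `Motives.IsSepQuotient`, [MumfordAV1970] §7), `X` separated; colimit cofans `eN c′ : E_N c′ → X′` (`c′ ∈ C_N`), `eK c : E_K c → X`
(`c ∈ C_K`) of smooth projective CURVES with Jacobians `J_N c′`, `J_K c` (★ `Motives.Jacobian`, `Nm_f = Jacobian.pushforward`); abelian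
varieties `Y_N`, `Y_K` with biproduct FANS `πN/ιN`, `πK/ιK` of the piece Jacobians (`ι_c ≫ π_c = 𝟙`, `ι_c ≫ π_{c′} = 0`, `Σ_c π_c ≫ ι_c = 𝟙`);
the piece maps `tu c′ : E_N c′ → E_K (bN c′)` of `p` (`tu c′ ≫ eK (bN c′) = eN c′ ≫ p`, ★ `Morphisms/CofanPieceMap`) and piece lifts
`tδ δ c′ : E_N c′ → E_N (φδ δ c′)` of the `act δ`.  (At the d6 node: `p = u_ℂ : X_N ⊗ ℂ → X_K ⊗ ℂ`, `Δ = K/N`.)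

PIECEWISE, `p` is Galois with group the IMAGE `H c′ ≤ Aut (E_N c′)` of the stabiliser `Stab_Δ(c′)` (★ `Over.exists_stabilizer_action_on_piece`:
«a `δ` may fix a piece pointwise and move other pieces»; ★ `exists_subgroup_isSepQuotient_pieceMap'`), and the pull-back `(tu c′)^*` is the
homomorphism `ttH c′` pinned by `Nm_{tu c′} ≫ ttH c′ = Σ_{h ∈ H c′} h_*` ([Lang1983AbelianVarieties] VIII §6 Thm. 13, ★
`Jacobian.exists_pushforward_comp_eq_sum`; [LangeRodriguez2022] Prop. 3.5.1 «`Nm_G = f^* ∘ Nm_f`»).  The GLOBAL identity `p^* p_* = Σ_{δ ∈ Δ} δ_*`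
counts every `δ`, so on the piece `c′` it sees `ttH c′` with the MULTIPLICITY `m c′ = #ker(Stab_Δ(c′) → Aut (E_N c′)) ≥ 1`:

* `Jacobian.exists_piece_pullback_pinned` — per piece: `H c′`, its finiteness, the quotient property of `tu c′`, `ttH c′`, `m c′ ≥ 1`, the
  `H`-pinning, and `Nm_{tu c′} ≫ (m c′ • ttH c′) = Σ_{δ ∈ Δ} M δ c′ c′` (`M δ c₁ c₂ := Nm` of THE lift `E_N c₁ → E_N c₂` of `act δ`, else `0`;
  fibre count ★ `MonoidHom.card_fiber_eq_of_mem_range`);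
* `Jacobian.fan_pieceMap_word_eq_sum`, `Jacobian.fan_pieceLift_word_eq_sum` — one-entry words `π ≫ Nm ≫ ι` in MATRIX form (`dite` entries);
* `Jacobian.fan_entry_pinning` — the ENTRY IDENTITY `U c₀ (bN c′) ≫ (m c′ • ttH c′) = Σ_δ M δ c₀ c′` (fibres of `p(ℂ)` are `Δ`-orbits, piece
  maps are onto: [SGA1] V Prop. 1.1, ★ `IsSepQuotient.exists_map_act_eq_of_map_eq`, ★ `surjective_map_pieceMap`; lifts compose);
* **`Jacobian.exists_fan_pullback_word`** — THE FAN PINNING: with `Wu := Σ_{c′} πN c′ ≫ Nm_{tu c′} ≫ ιK (bN c′)` (the word of `p_*`) and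
  `Wt := Σ_{c′} πK (bN c′) ≫ (m c′ • ttH c′) ≫ ιN c′` (the word of `p^*`), **`Wu ≫ Wt = Σ_δ Σ_{c′} πN c′ ≫ Nm_{tδ δ c′} ≫ ιN (φδ δ c′)`**, and `Wu` is
  right-cancellable against homomorphisms of abelian varieties (★ `Jacobian.eq_of_pushforward_comp_eq` per piece; every piece of `X` lies under
  a piece of `X′`, ★ `IsSepQuotient.surjective_map_of_isProjectiveOver`).

Cell `hodgecm-mathlib` (D-0151), crux `HLiu418` = stmt-HodgeConjecture-24832, d6 line, `stub_RosH` glue, socket (G3)/(P-ii) of the frame's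
`slot_letters` (A-p02 (g14) 2026-08-30 05:21Z; multiplicity design accepted by the d6 pen A-plan2 (g12) 05:33Z): consumed by the sequel
`HeckeTraceWordPieces` (the trace word of the level cover intertwines the Albanese trace).  COUNT-NEUTRAL capital: HC_CM is proved only modulo
the 7 printed citations until rung 0 closes.

## References
* [Lang1983AbelianVarieties] S. Lang, *Abelian Varieties* (1983), Ch. VIII §6 Thm. 13 (pp. 224–227: the trace `h_*`, `h_* f_* = Σ_g g_*`).
* [LangeRodriguez2022] H. Lange, R. E. Rodríguez, *Decomposition of Jacobians by Prym Varieties*, LNM 2310 (2022), §3.5.1 Prop. 3.5.1 (p. 65).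
* [Lange2023AbelianVarietiesComplex] H. Lange, *Abelian Varieties over the Complex Numbers* (2023), §4.5.2 (the norm map `N_f`).
* [SGA1] A. Grothendieck, M. Raynaud, *SGA 1*, Exp. V §1 Prop. 1.1 (fibres = orbits, `π` onto), Prop. 1.8.
* [MumfordAV1970] D. Mumford, *Abelian Varieties* (1970), §7 Thm. p. 66 and Remark (categorical quotients by finite groups).
* [GortzWedhorn2020] U. Görtz, T. Wedhorn, *Algebraic Geometry I* (2nd ed.), §(3.5) Prop. 3.10, Example 3.11 (p. 73) (coproducts of schemes).
-/

set_option autoImplicit false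

noncomputable section

open CategoryTheory CategoryTheory.Limits AlgebraicGeometry
open Literature.AlgebraicGeometry.Motives
open Literature.AlgebraicGeometry.Morphisms (Over.exists_stabilizer_action_on_piece Over.pieceMap_unique
  Over.pieceMap_index_unique Over.exists_pieceMap_of_isColimit_cofan_of_irreducibleSpace)

namespace Literature.NumberTheory.Automorphic.Liu2021.AppendixC

section FanPinning

variable {X' X : SchemeOver ℂ} {Δ : Type} [Group Δ] [Fintype Δ] (act : Δ →* Aut X') (p : X' ⟶ X)
  -- pieces of `X'`
  {CN : Type} [Fintype CN] (EN : CN → SchemeOver ℂ) (eN : ∀ c, EN c ⟶ X')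
  (JN : ∀ c, Jacobian (EN c))
  -- pieces of `X`
  {CK : Type} [Fintype CK] (EK : CK → SchemeOver ℂ) (eK : ∀ c, EK c ⟶ X)
  (JK : ∀ c, Jacobian (EK c))
  -- piece maps of `p`
  (bN : CN → CK) (tu : ∀ c', EN c' ⟶ EK (bN c'))

omit [Fintype CK] in
open scoped Classical in
/-- **Per-piece Galois data of a piecewise quotient.**  For a piece `E_N c′` of `X′` over the piece `E_K (bN c′)` of `X = X′/Δ` (piece map `tu c′`):
the lifts of the STABILISER of the piece form a finite subgroup `H ≤ Aut (E_N c′)` for which `tu c′` is a quotient for separated test objects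
(★ `exists_subgroup_isSepQuotient_pieceMap'`, ★ `Over.exists_stabilizer_action_on_piece`), the pinned pull-back `ttH` of `tu c′` exists
(`Nm_{tu} ≫ ttH = Σ_{h ∈ H} h_*`, ★ `Jacobian.exists_pushforward_comp_eq_sum`, [Lang1983AbelianVarieties] VIII §6 Thm. 13), and with
`m := #ker(Stab_Δ(c′) → Aut (E_N c′)) ≥ 1`: `Nm_{tu} ≫ (m • ttH) = Σ_{δ ∈ Δ} (lift of δ at c′ → c′)_*` (zero for the `δ` moving the piece).
[cite: Lang1983AbelianVarieties, Ch. VIII §6, Thm. 13 (pp. 224–227)] [cite: SGA1, Exp. V §1 Prop. 1.1, 1.8]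
[cite: GortzWedhorn2020, §(3.5) Proposition 3.10 and Example 3.11 (p. 73)] -/
theorem Jacobian.exists_piece_pullback_pinned (hX' : IsProjectiveOver X') (hX : IsSeparated X.hom)
    (hp : IsSepQuotient (fun δ => act δ) p)
    (hcN : IsColimit (Cofan.mk X' eN)) (hEN : ∀ c, IsSmoothProjective 1 (EN c))
    (hcK : IsColimit (Cofan.mk X eK)) (hEK : ∀ c, IsSmoothProjective 1 (EK c))
    (htu : ∀ c', tu c' ≫ eK (bN c') = eN c' ≫ p) (c' : CN) :
    ∃ (H : Subgroup (Aut (EN c'))) (_ : Finite ↥H)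
      (_ : IsSepQuotient (fun h : ↥H => (h : Aut (EN c'))) (tu c'))
      (ttH : (JK (bN c')).J ⟶ (JN c').J) (m : ℕ), 0 < m ∧
      (haveI := Fintype.ofFinite ↥H;
        (JN c').pushforward (JK (bN c')) (tu c') ≫ ttH = ∑ h : ↥H, (JN c').pushforward (JN c') (h : Aut (EN c')).hom) ∧
      (JN c').pushforward (JK (bN c')) (tu c') ≫ ((m : ℤ) • ttH) =
        ∑ δ : Δ, if hℓ : ∃ ℓ : EN c' ⟶ EN c', ℓ ≫ eN c' = eN c' ≫ (act δ).hom
          then (JN c').pushforward (JN c') hℓ.choose else 0 := by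
  classical
  haveI : ∀ c, IsIntegral (EN c).left := fun c => IsSmoothProjective.isIntegral_holds (hEN c)
  haveI : ∀ c, IsIntegral (EK c).left := fun c => IsSmoothProjective.isIntegral_holds (hEK c)
  haveI : ∀ c, Smooth (EK c).hom := fun c =>
    haveI := (hEK c).smoothOfRelativeDimension
    SmoothOfRelativeDimension.smooth 1 _
  -- uniqueness of lifts through the piece `c'`
  have huniq : ∀ {a a' : EN c' ⟶ EN c'} {g : EN c' ⟶ X'}, a ≫ eN c' = g → a' ≫ eN c' = g → a = a' :=
    fun h h' => pieceLift_unique eN hcN _ _ (h.trans h'.symm)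
  -- the stabiliser action on the piece `c'`
  obtain ⟨Δi, ai, hai, hmem⟩ := Over.exists_stabilizer_action_on_piece hcN act c'
  -- the piecewise quotient
  obtain ⟨H₀, hfin₀, h₁, h₂, hq₀⟩ := exists_subgroup_isSepQuotient_pieceMap' act p eN eK hX' hX hp hcN hcK
    (fun c => (hEN c).isProjectiveOver) (fun c => by haveI := (hEK c).isProjectiveOver.isProper; infer_instance)
    bN tu htu c'
  -- `H₀` is the image of the stabiliser action
  have hH : H₀ = ai.range := by
    ext h
    constructor
    · intro hh
      obtain ⟨g, hg⟩ := h₁ h hh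
      have hgi : g ∈ Δi := (hmem g).2 ⟨h.hom, hg⟩
      exact ⟨⟨g, hgi⟩, Iso.ext (huniq (hai ⟨g, hgi⟩) hg)⟩
    · rintro ⟨σ, rfl⟩
      obtain ⟨h', hh', hh'eq⟩ := h₂ (σ : Δ) (ai σ).hom (hai σ)
      have e : h' = ai σ := Iso.ext hh'eq
      exact e ▸ hh'
  subst hH
  letI hF : Fintype ↥ai.range := @Fintype.ofFinite _ hfin₀
  -- the pinned pull-back for the faithful piece group
  obtain ⟨ttH, httH⟩ := Jacobian.exists_pushforward_comp_eq_sum (dX := 1) (dY := 1) (hEN c') (hEK (bN c')) (JN c')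
    (JK (bN c')) ai.range.subtype (tu c') hq₀
  -- the multiplicity
  set m : ℕ := (Finset.univ.filter fun σ : ↥Δi => ai σ = 1).card with hm_def
  have hm_pos : 0 < m := Finset.card_pos.2 ⟨1, by simp⟩
  refine ⟨ai.range, hfin₀, hq₀, ttH, m, hm_pos, httH, ?_⟩
  rw [Preadditive.comp_zsmul, httH]
  -- the right-hand side as a sum over the stabiliser
  have hM : ∀ δ : Δ, (if hℓ : ∃ ℓ : EN c' ⟶ EN c', ℓ ≫ eN c' = eN c' ≫ (act δ).hom
      then (JN c').pushforward (JN c') hℓ.choose else 0) =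
      if hδ : δ ∈ (Δi : Set Δ) then (JN c').pushforward (JN c') (ai ⟨δ, hδ⟩).hom else 0 := by
    intro δ
    by_cases hδ : δ ∈ Δi
    · have hℓ : ∃ ℓ : EN c' ⟶ EN c', ℓ ≫ eN c' = eN c' ≫ (act δ).hom := (hmem δ).1 hδ
      rw [dif_pos hℓ, dif_pos (show δ ∈ (Δi : Set Δ) from hδ), huniq hℓ.choose_spec (hai ⟨δ, hδ⟩)]
    · have hℓ : ¬ ∃ ℓ : EN c' ⟶ EN c', ℓ ≫ eN c' = eN c' ≫ (act δ).hom := fun h => hδ ((hmem δ).2 h)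
      rw [dif_neg hℓ, dif_neg (show δ ∉ (Δi : Set Δ) from hδ)]
  rw [Finset.sum_congr rfl fun δ _ => hM δ]
  rw [Finset.sum_congr_set (Δi : Set Δ)
    (fun δ => if hδ : δ ∈ (Δi : Set Δ) then (JN c').pushforward (JN c') (ai ⟨δ, hδ⟩).hom else 0)
    (fun σ => (JN c').pushforward (JN c') (ai σ).hom) (fun δ hδ => dif_pos hδ) (fun δ hδ => dif_neg hδ)]
  -- fibre count of `ai : Δi →* Aut (EN c')` onto its range
  have hfib : ∀ b ∈ (Finset.univ : Finset ↥Δi).image ai,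
      (Finset.univ.filter fun σ : ↥Δi => ai σ = b).card = m := by
    intro b hb
    obtain ⟨σ, -, rfl⟩ := Finset.mem_image.1 hb
    exact MonoidHom.card_fiber_eq_of_mem_range ai ⟨σ, rfl⟩ ⟨1, map_one ai⟩
  have hcount : (∑ σ : ↥Δi, (JN c').pushforward (JN c') (ai σ).hom) =
      m • ∑ h : ↥ai.range, (JN c').pushforward (JN c') (h : Aut (EN c')).hom := by
    calc (∑ σ : ↥Δi, (JN c').pushforward (JN c') (ai σ).hom)
        = ∑ b ∈ (Finset.univ : Finset ↥Δi).image ai,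
            (Finset.univ.filter fun σ : ↥Δi => ai σ = b).card • (JN c').pushforward (JN c') b.hom :=
          Finset.sum_comp (fun a : Aut (EN c') => (JN c').pushforward (JN c') a.hom) ai
      _ = ∑ b ∈ (Finset.univ : Finset ↥Δi).image ai, m • (JN c').pushforward (JN c') b.hom :=
          Finset.sum_congr rfl fun b hb => by rw [hfib b hb]
      _ = m • ∑ b ∈ (Finset.univ : Finset ↥Δi).image ai, (JN c').pushforward (JN c') b.hom := by
          rw [Finset.smul_sum]
      _ = m • ∑ h : ↥ai.range, (JN c').pushforward (JN c') (h : Aut (EN c')).hom := by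
          congr 1
          exact Finset.sum_subtype (p := fun x => x ∈ ai.range) (F := hF) _
            (fun x => by simp only [Finset.mem_image, Finset.mem_univ, true_and, MonoidHom.mem_range])
            (fun a : Aut (EN c') => (JN c').pushforward (JN c') a.hom)
  change (m : ℤ) • ∑ h : ↥ai.range, (JN c').pushforward (JN c') (h : Aut (EN c')).hom =
    ∑ σ : ↥Δi, (JN c').pushforward (JN c') (ai σ).hom
  rw [hcount, natCast_zsmul]

omit [Fintype CN] in
open scoped Classical in
/-- **The word of the piece map `tu c₁` in MATRIX form**: `πN c₁ ≫ Nm_{tu c₁} ≫ ιK (bN c₁) = Σ_c πN c₁ ≫ U c₁ c ≫ ιK c` with the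
entry `U c₁ c = Nm_τ` for THE piece map `τ : E_N c₁ → E_K c` over `p` when there is one (only for `c = bN c₁`: ★ `Over.pieceMap_index_unique`,
★ `Over.pieceMap_unique`) and `0` otherwise. [cite: GortzWedhorn2020, §(3.5) Proposition 3.10 and Example 3.11 (p. 73)]
[cite: Lange2023AbelianVarietiesComplex, §4.5.2 (the norm map N_f)] -/
theorem Jacobian.fan_pieceMap_word_eq_sum {YN YK : AbelianVariety ℂ} (πN : ∀ c, YN ⟶ (JN c).J) (ιK : ∀ c, (JK c).J ⟶ YK)
    (hcK : IsColimit (Cofan.mk X eK)) (htu : ∀ c', tu c' ≫ eK (bN c') = eN c' ≫ p)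
    (c₁ : CN) [Nonempty (EN c₁).left] :
    πN c₁ ≫ (JN c₁).pushforward (JK (bN c₁)) (tu c₁) ≫ ιK (bN c₁) =
      ∑ c, πN c₁ ≫ (if h : ∃ τ : EN c₁ ⟶ EK c, τ ≫ eK c = eN c₁ ≫ p
        then (JN c₁).pushforward (JK c) h.choose else 0) ≫ ιK c := by
  rw [Finset.sum_eq_single (bN c₁)]
  · have h : ∃ τ : EN c₁ ⟶ EK (bN c₁), τ ≫ eK (bN c₁) = eN c₁ ≫ p := ⟨tu c₁, htu c₁⟩
    rw [dif_pos h, Over.pieceMap_unique hcK (f' := eN) (T := p) h.choose (tu c₁) h.choose_spec (htu c₁)]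
  · intro c _ hc
    rw [dif_neg, zero_comp, comp_zero]
    rintro ⟨τ, hτ⟩
    exact hc (Over.pieceMap_index_unique hcK (f' := eN) (T := p) τ (tu c₁) hτ (htu c₁))
  · intro h; exact absurd (Finset.mem_univ _) h

omit [Fintype Δ] in
open scoped Classical in
/-- **The word of a piece lift of a deck transformation in MATRIX form**: for a lift `tδ : E_N c₁ → E_N c⋆` of `act δ`,
`πN c₁ ≫ Nm_{tδ} ≫ ιN c⋆ = Σ_{c₂} πN c₁ ≫ M δ c₁ c₂ ≫ ιN c₂` with `M δ c₁ c₂ = Nm_ℓ` for THE lift `ℓ : E_N c₁ → E_N c₂` of `act δ` when there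
is one (only `c₂ = c⋆`) and `0` otherwise. [cite: GortzWedhorn2020, §(3.5) Proposition 3.10 and Example 3.11 (p. 73)]
[cite: Lange2023AbelianVarietiesComplex, §4.5.2 (the norm map N_f)] -/
theorem Jacobian.fan_pieceLift_word_eq_sum {YN : AbelianVariety ℂ} (πN : ∀ c, YN ⟶ (JN c).J) (ιN : ∀ c, (JN c).J ⟶ YN)
    (hcN : IsColimit (Cofan.mk X' eN)) (δ : Δ) (c₁ : CN) [Nonempty (EN c₁).left] {cs : CN} (tδ : EN c₁ ⟶ EN cs)
    (htδ : tδ ≫ eN cs = eN c₁ ≫ (act δ).hom) :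
    πN c₁ ≫ (JN c₁).pushforward (JN cs) tδ ≫ ιN cs =
      ∑ c₂, πN c₁ ≫ (if h : ∃ ℓ : EN c₁ ⟶ EN c₂, ℓ ≫ eN c₂ = eN c₁ ≫ (act δ).hom
        then (JN c₁).pushforward (JN c₂) h.choose else 0) ≫ ιN c₂ := by
  rw [Finset.sum_eq_single cs]
  · have h : ∃ ℓ : EN c₁ ⟶ EN cs, ℓ ≫ eN cs = eN c₁ ≫ (act δ).hom := ⟨tδ, htδ⟩
    rw [dif_pos h, Over.pieceMap_unique hcN (f' := eN) (T := (act δ).hom) h.choose tδ h.choose_spec htδ]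
  · intro c _ hc
    rw [dif_neg, zero_comp, comp_zero]
    rintro ⟨ℓ, hℓ⟩
    exact hc (Over.pieceMap_index_unique hcN (f' := eN) (T := (act δ).hom) ℓ tδ hℓ htδ)
  · intro h; exact absurd (Finset.mem_univ _) h

omit [Fintype CK] in
open scoped Classical in
/-- **The ENTRY IDENTITY of the fan pinning**: for pieces `c₀`, `c′` of `X′` and `T : J_K(bN c′) → J_N(c′)` pinned by the full stabiliser count
(`Nm_{tu c′} ≫ T = Σ_δ M δ c′ c′`), `U c₀ (bN c′) ≫ T = Σ_δ M δ c₀ c′`.  With no piece map `E_N c₀ → E_K (bN c′)` over `p` both sides vanish;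
otherwise the fibres of `p(ℂ)` are `Δ`-orbits and the piece maps are onto ([SGA1] V Prop. 1.1; ★ `IsSepQuotient.exists_map_act_eq_of_map_eq`,
★ `surjective_map_pieceMap`), so some `act g` carries `c₀` into `c′` by a lift `ℓ₁` with `τ = ℓ₁ ≫ tu c′`, and `Nm_τ ≫ T = Nm_{ℓ₁} ≫ Σ_δ M δ c′ c′
= Σ_δ M (δg) c₀ c′` (lifts compose, ★ `Over.pieceMap_unique`) is a re-indexing of `Σ_δ M δ c₀ c′`.
[cite: SGA1, Exp. V §1 Prop. 1.1] [cite: Lang1983AbelianVarieties, Ch. VIII §6, Thm. 13 (pp. 224–227)]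
[cite: GortzWedhorn2020, §(3.5) Proposition 3.10 and Example 3.11 (p. 73)] -/
theorem Jacobian.fan_entry_pinning (hX' : IsProjectiveOver X') (hX : IsSeparated X.hom)
    (hp : IsSepQuotient (fun δ => act δ) p)
    (hcN : IsColimit (Cofan.mk X' eN)) (hEN : ∀ c, IsSmoothProjective 1 (EN c))
    (hcK : IsColimit (Cofan.mk X eK)) (hEK : ∀ c, IsSmoothProjective 1 (EK c))
    (htu : ∀ c', tu c' ≫ eK (bN c') = eN c' ≫ p) (c₀ c' : CN) (T : (JK (bN c')).J ⟶ (JN c').J)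
    (hT : (JN c').pushforward (JK (bN c')) (tu c') ≫ T =
      ∑ δ : Δ, if hℓ : ∃ ℓ : EN c' ⟶ EN c', ℓ ≫ eN c' = eN c' ≫ (act δ).hom
        then (JN c').pushforward (JN c') hℓ.choose else 0) :
    (if h : ∃ τ : EN c₀ ⟶ EK (bN c'), τ ≫ eK (bN c') = eN c₀ ≫ p
        then (JN c₀).pushforward (JK (bN c')) h.choose else 0) ≫ T =
      ∑ δ : Δ, if hℓ : ∃ ℓ : EN c₀ ⟶ EN c', ℓ ≫ eN c' = eN c₀ ≫ (act δ).hom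
        then (JN c₀).pushforward (JN c') hℓ.choose else 0 := by
  haveI : ∀ c, IsIntegral (EN c).left := fun c => IsSmoothProjective.isIntegral_holds (hEN c)
  haveI : ∀ c, IsIntegral (EK c).left := fun c => IsSmoothProjective.isIntegral_holds (hEK c)
  have hmul : ∀ a b : Δ, (act (a * b)).hom = (act b).hom ≫ (act a).hom := fun a b => by rw [map_mul]; rfl
  by_cases hU : ∃ τ : EN c₀ ⟶ EK (bN c'), τ ≫ eK (bN c') = eN c₀ ≫ p
  swap
  · -- no piece map `c₀ → bN c′`: both sides vanish
    rw [dif_neg hU, zero_comp]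
    symm
    refine Finset.sum_eq_zero fun δ _ => ?_
    rw [dif_neg]
    rintro ⟨ℓ, hℓ⟩
    exact hU ⟨ℓ ≫ tu c', by rw [Category.assoc, htu, reassoc_of% hℓ, hp.1 δ]⟩
  rw [dif_pos hU]
  -- a deck transformation carrying the piece `c₀` into the piece `c′` (fibres of `p(ℂ)` are orbits; piece maps are onto)
  obtain ⟨g, ℓ₁, hℓ₁⟩ : ∃ (g : Δ) (ℓ₁ : EN c₀ ⟶ EN c'), ℓ₁ ≫ eN c' = eN c₀ ≫ (act g).hom := by
    obtain ⟨x₀⟩ := (hEN c₀).nonempty_algPoints ℂ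
    obtain ⟨y₀, hy₀⟩ := surjective_map_pieceMap act p eN eK hX' hX hp hcN hcK (fun c => (hEN c).isProjectiveOver)
      (fun c => by haveI := (hEK c).isProjectiveOver.isProper; infer_instance) bN tu htu c' (AlgPoints.map hU.choose x₀)
    have h1 : AlgPoints.map p (AlgPoints.map (eN c₀) x₀) = AlgPoints.map p (AlgPoints.map (eN c') y₀) := by
      rw [← AlgPoints.map_comp_apply, ← AlgPoints.map_comp_apply, ← hU.choose_spec, ← htu c', AlgPoints.map_comp_apply,
        AlgPoints.map_comp_apply, hy₀]
    obtain ⟨g, hg⟩ := IsSepQuotient.exists_map_act_eq_of_map_eq act p hX' hX hp h1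
    obtain ⟨c₂, ℓ, hℓ⟩ := exists_pieceLift act eN hcN g c₀
    have hpt : AlgPoints.map (eN c₂) (AlgPoints.map ℓ x₀) = AlgPoints.map (eN c') y₀ := by
      rw [← AlgPoints.map_comp_apply, hℓ, AlgPoints.map_comp_apply, hg]
    have hc : c₂ = c' :=
      pieceIndex_unique eN hcN (T := specOver ℂ ℂ) (q := AlgPoints.map (eN c') y₀) (AlgPoints.map ℓ x₀) y₀ hpt rfl
    subst hc
    exact ⟨g, ℓ, hℓ⟩
  -- `τ = ℓ₁ ≫ tu c′`, so `Nm_τ ≫ T = Nm_{ℓ₁} ≫ Σ_δ M δ c′ c′`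
  have hτ : hU.choose = ℓ₁ ≫ tu c' :=
    Over.pieceMap_unique hcK (f' := eN) (T := p) _ _ hU.choose_spec
      (by rw [Category.assoc, htu, reassoc_of% hℓ₁, hp.1 g])
  rw [hτ, (JN c₀).pushforward_comp (JN c') (JK (bN c')) ℓ₁ (tu c'), Category.assoc, hT, Preadditive.comp_sum]
  -- re-index `δ ↦ δ * g` and compare term by term: lifts compose
  refine Fintype.sum_equiv (Equiv.mulRight g) _ _ fun δ => ?_
  rw [Equiv.coe_mulRight]
  by_cases hM : ∃ ℓ' : EN c' ⟶ EN c', ℓ' ≫ eN c' = eN c' ≫ (act δ).hom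
  · have hM' : ∃ ℓ'' : EN c₀ ⟶ EN c', ℓ'' ≫ eN c' = eN c₀ ≫ (act (δ * g)).hom :=
      ⟨ℓ₁ ≫ hM.choose, by rw [Category.assoc, hM.choose_spec, reassoc_of% hℓ₁, hmul]⟩
    rw [dif_pos hM, dif_pos hM', ← (JN c₀).pushforward_comp (JN c') (JN c') ℓ₁ hM.choose]
    congr 1
    exact Over.pieceMap_unique hcN (f' := eN) (T := (act (δ * g)).hom) _ _
      (by rw [Category.assoc, hM.choose_spec, reassoc_of% hℓ₁, hmul]) hM'.choose_spec
  · have hM' : ¬ ∃ ℓ'' : EN c₀ ⟶ EN c', ℓ'' ≫ eN c' = eN c₀ ≫ (act (δ * g)).hom := by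
      rintro ⟨ℓ'', hℓ''⟩
      obtain ⟨c₃, ℓ₃, hℓ₃⟩ := exists_pieceLift act eN hcN δ c'
      have e : c₃ = c' :=
        Over.pieceMap_index_unique hcN (f' := eN) (T := (act (δ * g)).hom) (ℓ₁ ≫ ℓ₃) ℓ''
          (by rw [Category.assoc, hℓ₃, reassoc_of% hℓ₁, hmul]) hℓ''
      subst e
      exact hM ⟨ℓ₃, hℓ₃⟩
    rw [dif_neg hM, dif_neg hM', comp_zero]

open scoped Classical in
/-- **THE FAN PINNING OF THE PULL-BACK WORD (Y-level `p^* ∘ p_* = Σ_δ δ_*` on the biproducts of piece Jacobians).**  In the setting of the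
file header there are, for every piece `c′` of `X′`: the finite group `H c′ ≤ Aut (E_N c′)` of lifts of its stabiliser, for which `tu c′` is a
quotient for separated test objects; the pinned pull-back `ttH c′` (`Nm_{tu c′} ≫ ttH c′ = Σ_{h ∈ H c′} h_*`, [Lang1983AbelianVarieties] VIII §6
Thm. 13); a multiplicity `m c′ ≥ 1` (`= #ker(Stab_Δ(c′) → Aut (E_N c′))`); such that with `Wu := Σ_{c′} πN c′ ≫ Nm_{tu c′} ≫ ιK (bN c′)` (the
word of `p_*`) and `Wt := Σ_{c′} πK (bN c′) ≫ (m c′ • ttH c′) ≫ ιN c′` (the word of `p^*`): **`Wu ≫ Wt = Σ_δ Σ_{c′} πN c′ ≫ Nm_{tδ δ c′} ≫ ιN (φδ δ c′)`**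
(the word of `Σ_δ δ_*`; [LangeRodriguez2022] Prop. 3.5.1 «`Nm_G = f^* ∘ Nm_f`» piecewise), and `Wu` is right-cancellable against homomorphisms of
abelian varieties (each `Nm_{tu c′}` is, ★ `Jacobian.eq_of_pushforward_comp_eq`, and every piece of `X` lies under a piece of `X′`).
[cite: Lang1983AbelianVarieties, Ch. VIII §6, Thm. 13 (pp. 224–227)] [cite: LangeRodriguez2022, §3.5.1 Prop. 3.5.1 (p. 65)]
[cite: MumfordAV1970, §7 Thm. p. 66 and Remark] [cite: SGA1, Exp. V §1 Prop. 1.1, 1.8] -/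
theorem Jacobian.exists_fan_pullback_word {YN YK : AbelianVariety ℂ}
    (πN : ∀ c, YN ⟶ (JN c).J) (ιN : ∀ c, (JN c).J ⟶ YN) (πK : ∀ c, YK ⟶ (JK c).J) (ιK : ∀ c, (JK c).J ⟶ YK)
    (hιπN : ∀ c, ιN c ≫ πN c = 𝟙 _) (hιπN' : ∀ c₁ c₂, c₁ ≠ c₂ → ιN c₁ ≫ πN c₂ = 0)
    (htotK : ∑ c, πK c ≫ ιK c = 𝟙 YK) (hιπK : ∀ c, ιK c ≫ πK c = 𝟙 _) (hιπK' : ∀ c₁ c₂, c₁ ≠ c₂ → ιK c₁ ≫ πK c₂ = 0)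
    (hX' : IsProjectiveOver X') (hX : IsSeparated X.hom) (hp : IsSepQuotient (fun δ => act δ) p)
    (hcN : IsColimit (Cofan.mk X' eN)) (hEN : ∀ c, IsSmoothProjective 1 (EN c))
    (hcK : IsColimit (Cofan.mk X eK)) (hEK : ∀ c, IsSmoothProjective 1 (EK c))
    (htu : ∀ c', tu c' ≫ eK (bN c') = eN c' ≫ p)
    (φδ : Δ → CN → CN) (tδ : ∀ δ c', EN c' ⟶ EN (φδ δ c'))
    (htδ : ∀ δ c', tδ δ c' ≫ eN (φδ δ c') = eN c' ≫ (act δ).hom) :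
    ∃ (H : ∀ c', Subgroup (Aut (EN c'))) (_ : ∀ c', Finite ↥(H c'))
      (_ : ∀ c', IsSepQuotient (fun h : ↥(H c') => (h : Aut (EN c'))) (tu c'))
      (ttH : ∀ c', (JK (bN c')).J ⟶ (JN c').J) (m : CN → ℕ),
      (∀ c', 0 < m c') ∧
      (∀ c', haveI := Fintype.ofFinite ↥(H c');
        (JN c').pushforward (JK (bN c')) (tu c') ≫ ttH c' =
          ∑ h : ↥(H c'), (JN c').pushforward (JN c') (h : Aut (EN c')).hom) ∧
      (∑ c', πN c' ≫ (JN c').pushforward (JK (bN c')) (tu c') ≫ ιK (bN c')) ≫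
          (∑ c', πK (bN c') ≫ ((m c' : ℤ) • ttH c') ≫ ιN c') =
        ∑ δ, ∑ c', πN c' ≫ (JN c').pushforward (JN (φδ δ c')) (tδ δ c') ≫ ιN (φδ δ c') ∧
      (∀ ⦃Z : AbelianVariety ℂ⦄ ⦃a b : YK ⟶ Z⦄,
        (∑ c', πN c' ≫ (JN c').pushforward (JK (bN c')) (tu c') ≫ ιK (bN c')) ≫ a =
          (∑ c', πN c' ≫ (JN c').pushforward (JK (bN c')) (tu c') ≫ ιK (bN c')) ≫ b → a = b) := by
  haveI : ∀ c, IsIntegral (EN c).left := fun c => IsSmoothProjective.isIntegral_holds (hEN c)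
  haveI : ∀ c, IsIntegral (EK c).left := fun c => IsSmoothProjective.isIntegral_holds (hEK c)
  -- per-piece data
  have hpiece := fun c' => Jacobian.exists_piece_pullback_pinned act p EN eN JN EK eK JK bN tu hX' hX hp hcN hEN hcK hEK htu c'
  choose H hfin hq ttH m hm httH hpin using hpiece
  refine ⟨H, hfin, hq, ttH, m, hm, httH, ?_, ?_⟩
  · -- the Y-level pinning, piece of `X′` by piece
    rw [Preadditive.sum_comp, Finset.sum_comm]
    refine Finset.sum_congr rfl fun c₁ _ => ?_
    -- the word of `tu c₁` in matrix form, composed with `Wt`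
    rw [Jacobian.fan_pieceMap_word_eq_sum p EN eN JN EK eK JK bN tu πN ιK hcK htu c₁, Preadditive.sum_comp,
      Finset.sum_congr rfl fun c _ => (Preadditive.comp_sum _ _ _), Finset.sum_comm]
    -- collapse the middle contraction `ιK c ≫ πK (bN c₂)`
    have hcol : ∀ c₂ : CN,
        (∑ c, (πN c₁ ≫ (if h : ∃ τ : EN c₁ ⟶ EK c, τ ≫ eK c = eN c₁ ≫ p
            then (JN c₁).pushforward (JK c) h.choose else 0) ≫ ιK c) ≫
          (πK (bN c₂) ≫ ((m c₂ : ℤ) • ttH c₂) ≫ ιN c₂)) =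
        πN c₁ ≫ ((if h : ∃ τ : EN c₁ ⟶ EK (bN c₂), τ ≫ eK (bN c₂) = eN c₁ ≫ p
            then (JN c₁).pushforward (JK (bN c₂)) h.choose else 0) ≫ ((m c₂ : ℤ) • ttH c₂)) ≫ ιN c₂ := by
      intro c₂
      rw [Finset.sum_eq_single (bN c₂)]
      · simp only [Category.assoc]
        rw [reassoc_of% (hιπK (bN c₂))]
      · intro c _ hc
        simp only [Category.assoc]
        rw [reassoc_of% (hιπK' c (bN c₂) hc), zero_comp, comp_zero, comp_zero]
      · intro h; exact absurd (Finset.mem_univ _) h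
    rw [Finset.sum_congr rfl fun c₂ _ => hcol c₂]
    -- the entry identity, then back to the words of the piece lifts
    rw [Finset.sum_congr rfl fun c₂ _ => by
      rw [Jacobian.fan_entry_pinning act p EN eN JN EK eK JK bN tu hX' hX hp hcN hEN hcK hEK htu c₁ c₂ _ (hpin c₂),
        Preadditive.sum_comp, Preadditive.comp_sum]]
    rw [Finset.sum_comm]
    refine Finset.sum_congr rfl fun δ _ => ?_
    rw [Jacobian.fan_pieceLift_word_eq_sum act EN eN JN πN ιN hcN δ c₁ (tδ δ c₁) (htδ δ c₁)]
  · -- `Wu` is right-cancellable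
    intro Z a b hab
    -- every piece inclusion `ιK (bN c′)` equalises `a` and `b`
    have hι : ∀ c', ιK (bN c') ≫ a = ιK (bN c') ≫ b := by
      intro c'
      obtain ⟨P₀⟩ := (hEN c').nonempty_algPoints ℂ
      refine (JN c').eq_of_pushforward_comp_eq (JK (bN c')) (fun h : ↥(H c') => (h : Aut (EN c'))) (tu c') (hq c') P₀ ?_
      have h := congrArg (fun f => ιN c' ≫ f) hab
      simp only [Preadditive.sum_comp, Preadditive.comp_sum, Category.assoc] at h
      rw [Finset.sum_eq_single c', Finset.sum_eq_single c', reassoc_of% (hιπN c'), reassoc_of% (hιπN c')] at h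
      · exact h
      all_goals first
        | (intro c _ hc; rw [reassoc_of% (hιπN' c' c (Ne.symm hc)), zero_comp])
        | (intro h'; exact absurd (Finset.mem_univ _) h')
    -- every piece of `X` lies under a piece of `X′`
    have hsurj : Function.Surjective bN := by
      intro c
      haveI : IrreducibleSpace (specOver ℂ ℂ).left := inferInstanceAs (IrreducibleSpace (PrimeSpectrum ℂ))
      obtain ⟨z⟩ := (hEK c).nonempty_algPoints ℂ
      obtain ⟨x, hx⟩ := IsSepQuotient.surjective_map_of_isProjectiveOver act p hX' hX hp (AlgPoints.map (eK c) z)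
      obtain ⟨φ, x', hx'⟩ := Over.exists_pieceMap_of_isColimit_cofan_of_irreducibleSpace hcN
        (X' := fun _ : Unit => specOver ℂ ℂ) (fun _ => 𝟙 _) x
      refine ⟨φ (), ?_⟩
      have hpt : AlgPoints.map (eK (bN (φ ()))) (AlgPoints.map (tu (φ ())) (x' ())) = AlgPoints.map (eK c) z := by
        rw [← AlgPoints.map_comp_apply, htu, AlgPoints.map_comp_apply, AlgPoints.map_apply (eN _), hx' (),
          Category.id_comp, hx]
      exact pieceIndex_unique eK hcK (T := specOver ℂ ℂ) (q := AlgPoints.map (eK c) z) _ z hpt rfl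
    have hι' : ∀ c, ιK c ≫ a = ιK c ≫ b := fun c => by
      obtain ⟨c', rfl⟩ := hsurj c
      exact hι c'
    have hexp : ∀ f : YK ⟶ Z, f = ∑ c, πK c ≫ ιK c ≫ f := fun f => by
      conv_lhs => rw [← Category.id_comp f, ← htotK, Preadditive.sum_comp]
      simp only [Category.assoc]
    rw [hexp a, hexp b]
    exact Finset.sum_congr rfl fun c _ => by rw [hι' c]

end FanPinning

end Literature.NumberTheory.Automorphic.Liu2021.AppendixC

end
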